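import Summits.BirchSwinnertonDyer.Rank1Residual.X9.TransportPairs
import HarnessLib

/-!
# Class X9, `p = 5`: the TRANSPORT SWEEP, part A — `BSD(E,5)` for 1 Tamagawa-obstructed `5S4` pairs (0 of analytic rank `0`, 1 of analytic rank `1`)
# by Greenberg–Vatsal transport from LEVEL-LOWERED (or prime-traded) congruent partners — per-pair kernel records, the partner's `BSD(A,5)` a displayed binder

HONEST FRAMING (cell `b2b-bsdres-*`, verbatim): the cell deletes COMBINATION-SHAPED residual classes of
the rank-≤1 BSD formula from PUBLISHED theorems only and TYPES the construction-shaped remainder; this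
is not "finishing BSD". Class X9 (good ordinary `p ≥ 5`, `ρ̄_{E,p}` irreducible and not surjective) stays
TYPED at class level; everything here is PER PAIR; no lane verdict is changed; no named fact is introduced;
nothing is booked by this unit (the lane books, the referee rules). Unit `b2b-bsdres-x9`, gen 16
(this part also carries the two generic integer-model theorems used by every part).

## What this file does (our own work, hence `Summits/`)

Gens 10/15 (`X9/BSDpPartnerRankOne.lean`, `X9/TransportPairs.lean`): at a good ordinary irreducible `p ≥ 5` the
`p`-part of BSD PROPAGATES along mod-`p` congruences between curves of analytic rank `≤ 1` — C1 `A[p] ≅ E[p]` (finite by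
Kraus–Oesterlé 1992 Prop. 4) + `BSD(A,p)` + C2 (a unit coefficient of `𝓛_MSD(A)`) + C3 (Schneider's certificate for
whichever of `A`, `E` has analytic rank `1`) ⟹ Mazur's main conjecture for `(A,p)` with `μ = 0` (BCS 2025 Thm. 1.1.2 (a),
exponent forced to `0`) ⟹ the same for `(E,p)` (Greenberg–Vatsal 2000 Thm. (1.4)) ⟹ `BSD(E,p)` (rank `0`: Greenberg
Thm. 4.1 + interpolation + GZK; rank `1`: Perrin-Riou–Schneider + Perrin-Riou 1987 + GZK).
§1: the integer-model consumer for a TARGET OF ANALYTIC RANK `≤ 1` (`hC3`), and the variant whose partner has conductor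
`< 5000` (`BSD(A,p)` DISCHARGED by Miller 2011 Thm. 1.2, `hMiller`).
GEN 16's SWEEP (`HOME/b2b-bsdres-x9/X9-CENSUS-G16.md`, `g16/sweep/`):
after gen 15 exactly 66 X9 pairs (`N < 5·10⁵`, `r_an ≤ 1`; all `5S4`) had NO flag-free route — only the Jetchev–Cha
index bound at a non-surjective prime (x9 fold `JETCHEV-CHA`; lane flag `JET@nonsurj` / `Miller11-Thm54-Cha-case`): one
multiplicative prime `ℓ` with `5 ∣ c_ℓ` inflates every Heegner index. At that prime `E[5]` is UNRAMIFIED (`5 ∣ v_ℓ(Δ)`),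
so level lowering predicts a congruent newform of level `N_E/ℓ`; a screen of all `2 164 260` Cremona isogeny classes
(`cong_screen_g16.py`: conductor support + trace conditions at `ℓ ≤ 97`) finds a RATIONAL congruent partner below
`5·10⁵` for 32 of the 66 (29 level-lowered, `N_A ∣ N_E`; 3 congruent only to each other) and a USABLE one — analytic
rank `≤ 1`, good ordinary at `5`, flag-free two-engine Heegner certificate (x9 fold CERT, `ord₅ [A(K):ℤy_K] = 0`) —
for 26 = the 4 T-JET cells of gen 15 + the 22 pairs of this sweep (parts A–H; 19 level-lowered, 3 with the extra
multiplicative prime traded `7 ↔ 3`). This part: `129472bl1 ← 55488t1`.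
Certificates of THIS unit (kit j130867; gen-15 kit `jobT` byte copies + `make_input_g16.py`): C1 by TWO engines (PARI
`ellap`; ENGINE D pure-Python BSGS/Mestre, self-test PASS) up to the Kraus–Oesterlé bound — 22/22 OK, identical prime
counts; C3 by TWO engines (PARI `ellpadicheight`; pure-Python Mazur–Tate σ engine) for every rank-`1` target and partner,
all finite; C2 = gen 9's two-engine `μ(𝓛₅) = 0` table `g9/mu/MU-ALL.tsv` (790/790 X9 pairs; every partner is an X9 pair).
In the kernel these stay BINDERS (`hcong`, `hcertA`, `hSchA`, `hC3`).

References: Greenberg–Vatsal, Invent. Math. 142 (2000) Thm. (1.4); Burungale–Castella–Skinner, IMRN 2025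
Thm. 1.1.2 (a); Kraus–Oesterlé, Math. Ann. 293 (1992) Prop. 4; Greenberg, LNM 1716 (1999) Thm. 4.1;
Perrin-Riou 1987 §1.4; Balakrishnan–Müller–Stein 2016 Thm. 1.7 (Schneider); Mazur 1978 Prop. 6.3 (1);
Ribet 1990 (level lowering; motivation only); Miller 2011 Thm. 1.2 / Def. 1.1; Silverman AEC VII.1; Cremona's tables.
-/

set_option autoImplicit false

noncomputable section

open scoped Classical MatrixGroups ModularForm

open CongruenceSubgroup WeierstrassCurve Literature.NumberTheory.EllipticCurves
  Literature.NumberTheory.EllipticCurves.ModularForms Literature.NumberTheory.EllipticCurves.Rank1Residual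
  Literature.NumberTheory.EllipticCurves.Rank1Residual.Typed
  Literature.NumberTheory.EllipticCurves.Rank1Residual.X11RankOneCertificates
  Summit.BirchSwinnertonDyer.BirchSwinnertonDyer.Rank1Residual.IntModel
  Summit.BirchSwinnertonDyer.BirchSwinnertonDyer.Rank1Residual.X11RankOne
  Summit.BirchSwinnertonDyer.Rank1Residual.X11b

namespace Summit.BirchSwinnertonDyer.Rank1Residual.X9

/-! ### §1. Integer-model transport theorems for a target of analytic rank `≤ 1` -/

/-- **Target of analytic rank `≤ 1`, partner of analytic rank `≤ 1`, both given by globally minimal INTEGER models: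
every Galois / reduction hypothesis from DECIDABLE integer data** — the rank-`≤ 1` form of gen 15's
`bsdp_of_ainvs_of_bsdpPartner_of_congruences` (which is its case `r_an(E) = 0`). Target `W` with integral model
`[a₁,…,a₆]`: `p ∤ Δ` (good), kernel point count `#Ẽ(𝔽_p) = n_p` with `p ∤ p + 1 − n_p` (ordinary), a good prime
`ℓ ≠ p` with `#Ẽ(𝔽_ℓ) = n` and `X² − (ℓ + 1 − n)X + ℓ` root-free mod `p` (`E[p]` irreducible, Mazur 1978 Prop. 6.3 (1));
partner `A` with integral model `[a′₁,…,a′₆]`: `p ∤ Δ′`, `#Ã(𝔽_p) = n′_p` with `p ∤ p + 1 − n′_p`. Remaining binders: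
PUBLISHED `hKO … hGZK`; FINITE `r_an(E) ≤ 1`, `r_an(A) ≤ 1`, `BSDp A p`, C2 `hcertA`, C3 for the partner `hSchA`
(vacuous unless `r_an(A) = 1`), C3 for the target `hC3` (vacuous unless `r_an(E) = 1`: Schneider's certificate — the
cyclotomic `p`-adic height on `E(ℚ)` is non-degenerate), and C1 as the Kraus–Oesterlé list `hcong`. In rank `1` of the
target the conclusion passes through Greenberg–Vatsal's transfer of Mazur's main conjecture with `μ = 0` and the
rank-one leading-term step (Perrin-Riou–Schneider, Perrin-Riou 1987; `Wuthrich2014.missingPPartAt_of_mainConjecture_of_rank_one`).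
[cite: KrausOesterle1992, Prop. 4] [cite: GreenbergVatsal2000, Thm. (1.4) (arXiv p. 5)]
[cite: Mazur1978, §6 Prop. 6.3 (1) (p. 153)] [cite: PerrinRiou1987, §1.4 Cor. 1.8] [cite: BalakrishnanMullerStein2015, Thm. 1.7] -/
theorem bsdp_of_ainvs_of_bsdpPartner_of_congruences_of_analyticRank_le_one
    (hKO : KrausOesterle1992.prop4_torsionIso_of_congruences)
    (hBCS : burungale_castella_skinner_charIdeal_eq_padicLFunction)
    (hGr : greenberg_charValue_rankZero) (h5 : realPeriodRat_eq_unit_mul_plusPeriod)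
    (hGV : GreenbergVatsal2000.thm14_mainConjecture_transfer_of_torsionIso)
    (hS : Schneider1985_order_charGenerator) (hPR : perrinRiou_rankOne_leadingTerms)
    (hmodP : nonempty_modularParametrizationData) (hmodL : hasEntireLFunction_rat)
    (hGZK : rank_eq_analyticRank_of_analyticRank_le_one)
    (a1 a2 a3 a4 a6 : ℤ) {W : WeierstrassCurve ℚ} [W.IsElliptic] [W.IsGloballyMinimal]
    (hW : integralModelInt W = ⟨a1, a2, a3, a4, a6⟩)
    (b1 b2 b3 b4 b6 : ℤ) {A : WeierstrassCurve ℚ} [A.IsElliptic] [A.IsGloballyMinimal]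
    (hA : integralModelInt A = ⟨b1, b2, b3, b4, b6⟩)
    (p ℓ n np npA : ℕ) [Fact p.Prime] [Fact ℓ.Prime] (hp : 5 ≤ p)
    (hpΔ : ¬ (p : ℤ) ∣ discOf [a1, a2, a3, a4, a6])
    (hcardp : Nat.card (((⟨a1, a2, a3, a4, a6⟩ : WeierstrassCurve ℤ).map
      (Int.castRingHom (ZMod p))).toAffine.Point) = np)
    (hordp : ¬ (p : ℤ) ∣ (p : ℤ) + 1 - np)
    (hℓp : ℓ ≠ p) (hℓΔ : ¬ (ℓ : ℤ) ∣ discOf [a1, a2, a3, a4, a6])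
    (hcard : Nat.card (((⟨a1, a2, a3, a4, a6⟩ : WeierstrassCurve ℤ).map
      (Int.castRingHom (ZMod ℓ))).toAffine.Point) = n)
    (hnoroot : ∀ t : ℕ, t < p → ¬ (p : ℤ) ∣ (t : ℤ) ^ 2 - ((ℓ : ℤ) + 1 - n) * t + ℓ)
    (hpΔA : ¬ (p : ℤ) ∣ discOf [b1, b2, b3, b4, b6])
    (hcardpA : Nat.card (((⟨b1, b2, b3, b4, b6⟩ : WeierstrassCurve ℤ).map
      (Int.castRingHom (ZMod p))).toAffine.Point) = npA)
    (hordpA : ¬ (p : ℤ) ∣ (p : ℤ) + 1 - npA)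
    (hran : W.analyticRank ≤ 1) (hrA : A.analyticRank ≤ 1) (hbsdA : BSDp A p)
    (hSchA : A.analyticRank = 1 → ∀ Dh : PAdicHeightData A p, Dh.IsCanonical → SchneiderConjecture Dh)
    (hcertA : ∀ [NeZero (A.conductorNorm ℤ)] (fA : CuspForm (Gamma0 (A.conductorNorm ℤ)) 2),
        IsNewformOf A fA → ∀ (ϖ : ℚ), (ϖ : ℝ) * A.realPeriodRat = plusPeriod fA →
      ∃ n : ℕ, ‖PowerSeries.coeff n
        (PowerSeries.C (ϖ : ℚ_[p]) * padicLFunction fA (unitRoot A p : ℚ_[p]))‖ = 1)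
    (hcong : ∀ (ℓ : ℕ) [Fact ℓ.Prime],
      6 * ℓ < KrausOesterle1992.gammaZeroIndex (KrausOesterle1992.modulus W A) →
      (padicValNat ℓ (W.conductorNorm ℤ * A.conductorNorm ℤ) = 0 →
          (p : ℤ) ∣ W.frobeniusTrace ℓ - A.frobeniusTrace ℓ) ∧
        (padicValNat ℓ (W.conductorNorm ℤ * A.conductorNorm ℤ) = 1 →
          (p : ℤ) ∣ W.frobeniusTrace ℓ * A.frobeniusTrace ℓ - (ℓ + 1)))
    (hC3 : W.analyticRank = 1 → ∀ Dh : PAdicHeightData W p, Dh.IsCanonical → SchneiderConjecture Dh) :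
    BSDp W p := by
  have hΔ : (⟨a1, a2, a3, a4, a6⟩ : WeierstrassCurve ℤ).Δ = discOf [a1, a2, a3, a4, a6] :=
    intCurve_Δ a1 a2 a3 a4 a6
  have hΔA : (⟨b1, b2, b3, b4, b6⟩ : WeierstrassCurve ℤ).Δ = discOf [b1, b2, b3, b4, b6] :=
    intCurve_Δ b1 b2 b3 b4 b6
  have hgood : W.HasGoodReductionAtPrime p :=
    hasGoodReductionAtPrime_of_not_dvd W p (by rw [minimalDiscriminantInt_eq hW, hΔ]; exact hpΔ)
  have hord : ¬ (p : ℤ) ∣ W.frobeniusTrace p := by rw [frobeniusTrace_eq hW hcardp]; exact hordp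
  have hgoodA : A.HasGoodReductionAtPrime p :=
    hasGoodReductionAtPrime_of_not_dvd A p (by rw [minimalDiscriminantInt_eq hA, hΔA]; exact hpΔA)
  have hordA : ¬ (p : ℤ) ∣ A.frobeniusTrace p := by rw [frobeniusTrace_eq hA hcardpA]; exact hordpA
  have hirr : W.HasIrreducibleModPGaloisRep p := by
    refine hasIrreducibleModPGaloisRep_of_intModel_of_noroot hW p ℓ hℓp (by rw [hΔ]; exact hℓΔ) hcard
      (forall_zmod_of_forall_lt fun t ht h0 ↦ hnoroot t ht ?_)
    rw [← ZMod.intCast_zmod_eq_zero_iff_dvd]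
    push_cast at h0 ⊢
    linear_combination h0
  exact bsdp_of_bsdpPartner_of_congruences_of_partnerRank_le_one_of_irr W A p hKO hBCS hGr h5 hGV hS
    hPR hmodP hmodL hGZK hran hgood hord hp hirr hgoodA hordA hrA hbsdA hSchA hcertA hcong hC3

/-- **The same with a partner of conductor `< 5000`: `BSD(A,p)` DISCHARGED by Miller 2011 / Creutz–Miller 2012**
(`hMiller` = `bsdp_of_irreducible_of_conductor_lt`, the published theorem "`r_an(A) ≤ 1`, `N_A < 5000`, `A[p]`
irreducible ⟹ `BSD(A,p)`"; `A[p]` is irreducible because `E[p]` is, along the Kraus–Oesterlé isomorphism). Every binder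
is a PUBLISHED fact (`hKO`, `hMiller`, `hBCS`, `hGr`, `h5`, `hGV`, `hS`, `hPR`, `hmodP`, `hmodL`, `hGZK`) or a FINITE
certificate (`r_an(E) ≤ 1`, `r_an(A) ≤ 1`, `N_A < 5000`, `hcertA`, `hcong`, `hSchA`, `hC3`); the Galois / reduction data
are decided in the kernel from the two integer models as above.
[cite: Miller2011LMS, Thm. 1.2] [cite: CreutzMiller2012, Thm. 1.1] [cite: KrausOesterle1992, Prop. 4]
[cite: GreenbergVatsal2000, Thm. (1.4) (arXiv p. 5)] [cite: Mazur1978, §6 Prop. 6.3 (1) (p. 153)] -/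
theorem bsdp_of_ainvs_of_conductor_lt_of_congruences_of_analyticRank_le_one
    (hKO : KrausOesterle1992.prop4_torsionIso_of_congruences)
    (hMiller : bsdp_of_irreducible_of_conductor_lt)
    (hBCS : burungale_castella_skinner_charIdeal_eq_padicLFunction)
    (hGr : greenberg_charValue_rankZero) (h5 : realPeriodRat_eq_unit_mul_plusPeriod)
    (hGV : GreenbergVatsal2000.thm14_mainConjecture_transfer_of_torsionIso)
    (hS : Schneider1985_order_charGenerator) (hPR : perrinRiou_rankOne_leadingTerms)
    (hmodP : nonempty_modularParametrizationData) (hmodL : hasEntireLFunction_rat)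
    (hGZK : rank_eq_analyticRank_of_analyticRank_le_one)
    (a1 a2 a3 a4 a6 : ℤ) {W : WeierstrassCurve ℚ} [W.IsElliptic] [W.IsGloballyMinimal]
    (hW : integralModelInt W = ⟨a1, a2, a3, a4, a6⟩)
    (b1 b2 b3 b4 b6 : ℤ) {A : WeierstrassCurve ℚ} [A.IsElliptic] [A.IsGloballyMinimal]
    (hA : integralModelInt A = ⟨b1, b2, b3, b4, b6⟩)
    (p ℓ n np npA : ℕ) [Fact p.Prime] [Fact ℓ.Prime] (hp : 5 ≤ p)
    (hpΔ : ¬ (p : ℤ) ∣ discOf [a1, a2, a3, a4, a6])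
    (hcardp : Nat.card (((⟨a1, a2, a3, a4, a6⟩ : WeierstrassCurve ℤ).map
      (Int.castRingHom (ZMod p))).toAffine.Point) = np)
    (hordp : ¬ (p : ℤ) ∣ (p : ℤ) + 1 - np)
    (hℓp : ℓ ≠ p) (hℓΔ : ¬ (ℓ : ℤ) ∣ discOf [a1, a2, a3, a4, a6])
    (hcard : Nat.card (((⟨a1, a2, a3, a4, a6⟩ : WeierstrassCurve ℤ).map
      (Int.castRingHom (ZMod ℓ))).toAffine.Point) = n)
    (hnoroot : ∀ t : ℕ, t < p → ¬ (p : ℤ) ∣ (t : ℤ) ^ 2 - ((ℓ : ℤ) + 1 - n) * t + ℓ)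
    (hpΔA : ¬ (p : ℤ) ∣ discOf [b1, b2, b3, b4, b6])
    (hcardpA : Nat.card (((⟨b1, b2, b3, b4, b6⟩ : WeierstrassCurve ℤ).map
      (Int.castRingHom (ZMod p))).toAffine.Point) = npA)
    (hordpA : ¬ (p : ℤ) ∣ (p : ℤ) + 1 - npA)
    (hran : W.analyticRank ≤ 1) (hrA : A.analyticRank ≤ 1) (hNA : A.conductorNorm ℤ < 5000)
    (hSchA : A.analyticRank = 1 → ∀ Dh : PAdicHeightData A p, Dh.IsCanonical → SchneiderConjecture Dh)
    (hcertA : ∀ [NeZero (A.conductorNorm ℤ)] (fA : CuspForm (Gamma0 (A.conductorNorm ℤ)) 2),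
        IsNewformOf A fA → ∀ (ϖ : ℚ), (ϖ : ℝ) * A.realPeriodRat = plusPeriod fA →
      ∃ n : ℕ, ‖PowerSeries.coeff n
        (PowerSeries.C (ϖ : ℚ_[p]) * padicLFunction fA (unitRoot A p : ℚ_[p]))‖ = 1)
    (hcong : ∀ (ℓ : ℕ) [Fact ℓ.Prime],
      6 * ℓ < KrausOesterle1992.gammaZeroIndex (KrausOesterle1992.modulus W A) →
      (padicValNat ℓ (W.conductorNorm ℤ * A.conductorNorm ℤ) = 0 →
          (p : ℤ) ∣ W.frobeniusTrace ℓ - A.frobeniusTrace ℓ) ∧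
        (padicValNat ℓ (W.conductorNorm ℤ * A.conductorNorm ℤ) = 1 →
          (p : ℤ) ∣ W.frobeniusTrace ℓ * A.frobeniusTrace ℓ - (ℓ + 1)))
    (hC3 : W.analyticRank = 1 → ∀ Dh : PAdicHeightData W p, Dh.IsCanonical → SchneiderConjecture Dh) :
    BSDp W p := by
  have hΔ : (⟨a1, a2, a3, a4, a6⟩ : WeierstrassCurve ℤ).Δ = discOf [a1, a2, a3, a4, a6] :=
    intCurve_Δ a1 a2 a3 a4 a6
  have hΔA : (⟨b1, b2, b3, b4, b6⟩ : WeierstrassCurve ℤ).Δ = discOf [b1, b2, b3, b4, b6] :=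
    intCurve_Δ b1 b2 b3 b4 b6
  have hgood : W.HasGoodReductionAtPrime p :=
    hasGoodReductionAtPrime_of_not_dvd W p (by rw [minimalDiscriminantInt_eq hW, hΔ]; exact hpΔ)
  have hord : ¬ (p : ℤ) ∣ W.frobeniusTrace p := by rw [frobeniusTrace_eq hW hcardp]; exact hordp
  have hgoodA : A.HasGoodReductionAtPrime p :=
    hasGoodReductionAtPrime_of_not_dvd A p (by rw [minimalDiscriminantInt_eq hA, hΔA]; exact hpΔA)
  have hordA : ¬ (p : ℤ) ∣ A.frobeniusTrace p := by rw [frobeniusTrace_eq hA hcardpA]; exact hordpA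
  have hirr : W.HasIrreducibleModPGaloisRep p := by
    refine hasIrreducibleModPGaloisRep_of_intModel_of_noroot hW p ℓ hℓp (by rw [hΔ]; exact hℓΔ) hcard
      (forall_zmod_of_forall_lt fun t ht h0 ↦ hnoroot t ht ?_)
    rw [← ZMod.intCast_zmod_eq_zero_iff_dvd]
    push_cast at h0 ⊢
    linear_combination h0
  obtain ⟨e, he⟩ := KrausOesterle1992.torsionIso_of_congruences hKO W A p hirr hcong
  have hirrA : A.HasIrreducibleModPGaloisRep p :=
    hasIrreducibleModPGaloisRep_of_torsionIso_symm e he hirr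
  exact bsdp_of_bsdpPartner_of_partnerRank_le_one_of_irr W A p hBCS hGr h5 hGV hS hPR hmodP hmodL hGZK
    hran hgood hord hp hirr hgoodA hordA hrA (hMiller A hrA hNA p Fact.out hirrA) hSchA hcertA ⟨e, he⟩ hC3

/-! ### §2. Frobenius point counts (kernel-decided data) -/

/-- `#Ẽ(𝔽₅) = 4` (`a₅ = 2`: good ORDINARY) for Cremona's model `129472bl1` (kernel count). [folklore] -/
theorem card_t129472bl1_5 :
    Nat.card (((⟨0, 1, 0, -14257, 608527⟩ : WeierstrassCurve ℤ).map
      (Int.castRingHom (ZMod 5))).toAffine.Point) = 4 := by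
  rw [@WeierstrassCurve.natCard_point_eq_one_add_card (ZMod 5) (@ZMod.instField 5 ⟨by norm_num⟩) _ _ _
    (by decide +kernel), @card_sol_eq_sum_euler (ZMod 5) (@ZMod.instField 5 ⟨by norm_num⟩) _ _
    (by rw [ZMod.ringChar_zmod_n]; decide), ZMod.card]
  decide +kernel

/-- `#Ẽ(𝔽₁₁) = 8` (`a₁₁ = 4`; `X² − a₁₁X + 11` root-free mod `5`) for Cremona's model `129472bl1` (kernel count). [folklore] -/
theorem card_t129472bl1_11 :
    Nat.card (((⟨0, 1, 0, -14257, 608527⟩ : WeierstrassCurve ℤ).map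
      (Int.castRingHom (ZMod 11))).toAffine.Point) = 8 := by
  rw [@WeierstrassCurve.natCard_point_eq_one_add_card (ZMod 11) (@ZMod.instField 11 ⟨by norm_num⟩) _ _ _
    (by decide +kernel), @card_sol_eq_sum_euler (ZMod 11) (@ZMod.instField 11 ⟨by norm_num⟩) _ _
    (by rw [ZMod.ringChar_zmod_n]; decide), ZMod.card]
  decide +kernel

/-- `#Ã(𝔽₅) = 4` (`a₅ = 2`: good ORDINARY) for Cremona's model `55488t1` (kernel count). [folklore] -/
theorem card_s55488t1_5 :
    Nat.card (((⟨0, -1, 0, 26203, 1154373⟩ : WeierstrassCurve ℤ).map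
      (Int.castRingHom (ZMod 5))).toAffine.Point) = 4 := by
  rw [@WeierstrassCurve.natCard_point_eq_one_add_card (ZMod 5) (@ZMod.instField 5 ⟨by norm_num⟩) _ _ _
    (by decide +kernel), @card_sol_eq_sum_euler (ZMod 5) (@ZMod.instField 5 ⟨by norm_num⟩) _ _
    (by rw [ZMod.ringChar_zmod_n]; decide), ZMod.card]
  decide +kernel

/-! ### §3. Ellipticity and global minimality of the literal models (kernel) -/

/-- `129472bl1`'s Cremona model is an elliptic curve (`Δ ≠ 0`, kernel). [cite: Cremona2006, Table 1 (Cremona label 129472bl1)] -/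
theorem isElliptic_t129472bl1 : (⟨0, 1, 0, -14257, 608527⟩ : WeierstrassCurve ℚ).IsElliptic :=
  isElliptic_of_discOf_ne_zero 0 1 0 (-14257) 608527 (by decide +kernel)

/-- `129472bl1`'s Cremona model is globally minimal (Kraus' bounded criterion, kernel). [cite: SilvermanAEC2009, VII.1 Remark 1.1] -/
theorem isGloballyMinimal_t129472bl1 : (⟨0, 1, 0, -14257, 608527⟩ : WeierstrassCurve ℚ).IsGloballyMinimal :=
  isGloballyMinimal_of_krausCriterion_bounded₂ 0 1 0 (-14257) 608527 (by decide +kernel) (by decide +kernel)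
    (by decide +kernel)

/-- `55488t1`'s Cremona model is an elliptic curve (`Δ ≠ 0`, kernel). [cite: Cremona2006, Table 1 (Cremona label 55488t1)] -/
theorem isElliptic_s55488t1 : (⟨0, -1, 0, 26203, 1154373⟩ : WeierstrassCurve ℚ).IsElliptic :=
  isElliptic_of_discOf_ne_zero 0 (-1) 0 26203 1154373 (by decide +kernel)

/-- `55488t1`'s Cremona model is globally minimal (Kraus' bounded criterion, kernel). [cite: SilvermanAEC2009, VII.1 Remark 1.1] -/
theorem isGloballyMinimal_s55488t1 : (⟨0, -1, 0, 26203, 1154373⟩ : WeierstrassCurve ℚ).IsGloballyMinimal :=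
  isGloballyMinimal_of_krausCriterion_bounded₂ 0 (-1) 0 26203 1154373 (by decide +kernel) (by decide +kernel)
    (by decide +kernel)

/-! ### §4. The records -/

/-- **`BSD(E,5)` for `129472bl1`** (`N = 129472 = 2⁶·7·17²`; good ORDINARY at `5`, `a₅ = 2`; Cremona model `[0, 1, 0,
-14257, 608527]`; `ρ̄_{E,5}` irreducible (Frobenius witness `ℓ = 11`: `#Ẽ(𝔽₁₁) = 8`, `a₁₁ = 4`) and — census datum —
of EXCEPTIONAL type `5S4`; analytic rank `1`; `#Ш_an = 1`; `∏c_ℓ = 30` (`ord₅ ∏c_ℓ ≥ 1`: Tamagawa-obstructed Heegner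
index); route of record: the Jetchev–Cha index bound ONLY (x9 fold `JETCHEV-CHA`: `D = -47`, `m = 60`, `ord₅ m = 1` =
the Tamagawa valuation; flag `Miller11-Thm54-Cha-case` / lane `JET@nonsurj`; its `5`-descent line is [GRH] only)) —
**from the mod-`5` CONGRUENT partner `55488t1`** (`N_A = 55488 = 2⁶·3·17²`, NOT a divisor of `N_E`: the two curves are
congruent newforms with different extra multiplicative primes over the common level `18496`; `5S4`, `a₅(A) = 2`,
`r_an(A) = 0`, `#Ш_an(A) = 4`, `∏c_ℓ(A) = 2`; Heegner route of record CERT `D = -47`, `m = 24`, `ord₅ m = 0`, two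
engines (x9 fold), unflagged) by Greenberg–Vatsal transport
(`bsdp_of_ainvs_of_bsdpPartner_of_congruences_of_analyticRank_le_one`: `BSDp A 5` (`hbsdA`, the binder the partner's
certificate discharges)) + C2 + C3 ⟹ Mazur's main conjecture for `(A,5)` with `μ = 0` ⟹ the same for `(E,5)` along
`A[5] ≅ E[5]` ⟹ `BSD(E,5)`; in rank `1` of the target the last step is the rank-one leading-term comparison
(Perrin-Riou–Schneider, Perrin-Riou 1987) with `hC3`. Kernel-decided: `Δ ≠ 0` and minimality of both models
(`isElliptic_*`, `isGloballyMinimal_*` discharge the instance binders), `#Ẽ(𝔽₅) = 4`, `#Ã(𝔽₅) = 4`, `E[5]`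
irreducible. Certificates (unit `b2b-bsdres-x9` gen 16, kit j130867; `HOME/b2b-bsdres-x9/g16/sweep/`): C1 = `hcong`
with `M = 388 416` (`S = ∅`), `μ(M) = 940 032`, bound `B = 156 671`: all `14 405` primes `ℓ ≤ B` with `v_ℓ(N_E N_A) ≤
1` checked, `0` exceptions, TWO engines (PARI `ellap` via cypari2; ENGINE D pure-Python BSGS/Mestre, identical count,
`0` fallbacks); C2 = `hcertA` (`μ(𝓛₅(A)) = 0`: gen 9 `MU-ALL.tsv`, engines B and C, `λ = 0`); `hSchA` vacuous
(`r_an(A) = 0`); C3 for the target = `hC3` (PARI `ellpadicheight` `[v(f),v(g)] = [1,2]`, `v₅(s₂) = 1`, `v₅(f − s₂g) =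
1` + Mazur–Tate σ engine `v₅(h) = 0` (kit j130867); both finite ⇒ the cyclotomic `5`-adic height of `E`'s Cremona
generator is non-zero). Binders otherwise PUBLISHED (`hKO` … `hGZK`); FINITE `r_an(E) ≤ 1`, `r_an(A) ≤ 1`. Per pair;
nothing booked; no Jetchev, no descent of the target, no GRH.
[cite: GreenbergVatsal2000, Thm. (1.4) (arXiv p. 5)] [cite: KrausOesterle1992, Prop. 4] [cite: Miller2011LMS, Def. 1.1]
[cite: Cremona2006, Table 1 (Cremona labels 129472bl1, 55488t1)] -/
theorem bsdp_t129472bl1_of_bsdp_s55488t1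
    (hKO : KrausOesterle1992.prop4_torsionIso_of_congruences)
    (hBCS : burungale_castella_skinner_charIdeal_eq_padicLFunction)
    (hGr : greenberg_charValue_rankZero) (h5 : realPeriodRat_eq_unit_mul_plusPeriod)
    (hGV : GreenbergVatsal2000.thm14_mainConjecture_transfer_of_torsionIso)
    (hS : Schneider1985_order_charGenerator) (hPR : perrinRiou_rankOne_leadingTerms)
    (hmodP : nonempty_modularParametrizationData) (hmodL : hasEntireLFunction_rat)
    (hGZK : rank_eq_analyticRank_of_analyticRank_le_one)
    (W A : WeierstrassCurve ℚ) [W.IsElliptic] [W.IsGloballyMinimal] [A.IsElliptic] [A.IsGloballyMinimal]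
    [Fact (Nat.Prime 5)]
    (hW : W = ⟨0, 1, 0, -14257, 608527⟩) (hA : A = ⟨0, -1, 0, 26203, 1154373⟩)
    (hran : W.analyticRank ≤ 1) (hrA : A.analyticRank ≤ 1) (hbsdA : BSDp A 5)
    (hSchA : A.analyticRank = 1 → ∀ Dh : PAdicHeightData A 5, Dh.IsCanonical → SchneiderConjecture Dh)
    (hcertA : ∀ [NeZero (A.conductorNorm ℤ)] (fA : CuspForm (Gamma0 (A.conductorNorm ℤ)) 2),
        IsNewformOf A fA → ∀ (ϖ : ℚ), (ϖ : ℝ) * A.realPeriodRat = plusPeriod fA →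
      ∃ n : ℕ, ‖PowerSeries.coeff n
        (PowerSeries.C (ϖ : ℚ_[5]) * padicLFunction fA (unitRoot A 5 : ℚ_[5]))‖ = 1)
    (hcong : ∀ (ℓ : ℕ) [Fact ℓ.Prime],
      6 * ℓ < KrausOesterle1992.gammaZeroIndex (KrausOesterle1992.modulus W A) →
      (padicValNat ℓ (W.conductorNorm ℤ * A.conductorNorm ℤ) = 0 →
          (5 : ℤ) ∣ W.frobeniusTrace ℓ - A.frobeniusTrace ℓ) ∧
        (padicValNat ℓ (W.conductorNorm ℤ * A.conductorNorm ℤ) = 1 →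
          (5 : ℤ) ∣ W.frobeniusTrace ℓ * A.frobeniusTrace ℓ - (ℓ + 1)))
    (hC3 : W.analyticRank = 1 → ∀ Dh : PAdicHeightData W 5, Dh.IsCanonical → SchneiderConjecture Dh) :
    BSDp W 5 := by
  have hIW : integralModelInt W = ⟨0, 1, 0, -14257, 608527⟩ :=
    integralModelInt_eq_of_map_eq _ (by rw [hW]; ext <;> simp [WeierstrassCurve.map])
  have hIA : integralModelInt A = ⟨0, -1, 0, 26203, 1154373⟩ :=
    integralModelInt_eq_of_map_eq _ (by rw [hA]; ext <;> simp [WeierstrassCurve.map])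
  haveI : Fact (Nat.Prime 11) := ⟨by norm_num⟩
  exact bsdp_of_ainvs_of_bsdpPartner_of_congruences_of_analyticRank_le_one hKO hBCS hGr h5 hGV hS hPR hmodP hmodL hGZK
    0 1 0 (-14257) 608527 hIW
    0 (-1) 0 26203 1154373 hIA
    5 11 8 4 4 (by norm_num) (by decide +kernel) card_t129472bl1_5 (by decide) (by decide)
    (by decide +kernel) card_t129472bl1_11 (by decide) (by decide +kernel) card_s55488t1_5 (by decide)
    hran hrA hbsdA hSchA hcertA hcong hC3

end Summit.BirchSwinnertonDyer.Rank1Residual.X9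

end
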